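import Mathlib
import Literature.Analysis.FluidPDE.TypeIAncientMild
import Literature.Analysis.FluidPDE.SelfSimilar
import Summits.NavierStokesRegularity.NavierStokesRegularity.Theorems.SymmetryModuliCountSymmetricLiouville
import Summits.NavierStokesRegularity.NavierStokesRegularity.Theorems.ExtremiserTransienceNearExtremalTransiencePerFlowEternalSymmetry
import Summits.NavierStokesRegularity.NavierStokesRegularity.Theorems.SqueezeCycleExtremalElementExistsExtraction
import Summits.NavierStokesRegularity.NavierStokesRegularity.Theorems.DssFarFieldSlavingBlowupTypeIDssProfileSimilarityEnstrophyTimeOnlyThreshold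
import HarnessLib

/-!
# Census block A2 (amplitude meters), cells A2ffC / A2ffP (DECIDED — EMPTY), A2ff0 ⇔ A2ff1 ⇔ A2ffQ ⇔ A2ffW (OPEN) — instrument «FARFIELD METER», LINE «farfield-meter» port,
# part 1/2: §A the instrument predicates `Decays` / `FarQuiet`, §B recentring (the lever: far-field limits lie in the class), §C one-slice killers (tree theorems,
# packaged), §D the laws (`decays_of_decays_slice`, `decays_of_farQuiet`, `pattern_eq_zero`, `farLimit_eq_zero`, `decays_of_asymptotic_pattern`)

Re-homed for the scenario census (typer seat ns-census-typer-1 g9; the cells A2ffC / A2ffP are MEMBERS OF RECORD «PROVED EMPTY IN KERNEL IN FILES» of block A2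
since census v1.94 (critic idea-crit-3 g8 PASS 07:37:30Z — no price; ref ns-census-ref g12 PRE-CHECK ✓ §17.7 item 62; lead-presearch label item 62); this port
makes them TREE-decided): VERBATIM PORT of ns-idea-2 LINE g16-1 «farfield-meter», `pub/ideators/ns-idea-2/lines/farfield-meter/line-farfield-meter.lean` sha16
3f153089dab25607 (410 l., lean check rc 0, 0 sorry), split for the 400-line rule into `ScenarioCensusFarfieldMeter` (§A–§D) → `…FarfieldMeterRows` (§E + census
KEYS).  Lean text VERBATIM in namespace `…Theorems.ScenarioCensus.FarfieldMeter` (the line's `…Lines.FarfieldMeter` re-homed); port edits: `local notation "E3"`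
→ `abbrev E3` (typer lint: no notation in port files), `set_option linter.unusedVariables false` dropped (ref §17.7: a port must drop it; the tree builds with 0
warnings), `@[conjecture]` on the OPEN rows `Row_A2ff0` / `Row_A2ff1` / `Row_A2ffQ` / `Row_A2ffW` (typed only).  Statements untouched.

No census VALUE is moved here (the cells become TREE-decided by name; booking is the lead's); NS regularity is NOT proved; (L′) ⟨10661⟩ is untouched; no
summit statement is proved by this file.
-/

-- the summit and its single problem share the name `NavierStokesRegularity` (D-0017 nested layout)
set_option linter.dupNamespace false

noncomputable section

open Set Function Filter
open scoped Topology
open Literature.Analysis.FluidPDE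
open Summit.NavierStokesRegularity.NavierStokesRegularity.Theorems
open Summit.NavierStokesRegularity.NavierStokesRegularity.Theorems.SymmetryModuliCountSymmetricLiouville
open Summit.NavierStokesRegularity.NavierStokesRegularity.Theorems.NearExtremalTransiencePerFlow.FilamentSelection
open Summit.NavierStokesRegularity.NavierStokesRegularity.Theorems.SimilarityEnstrophy

namespace Summit.NavierStokesRegularity.NavierStokesRegularity.Theorems.ScenarioCensus.FarfieldMeter

/-- `ℝ³` (the line's `local notation "E3"`, spelled as a reducible abbreviation for the tree). -/
abbrev E3 := EuclideanSpace ℝ (Fin 3)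

variable {C : ℝ} {u : ℝ → E3 → E3}

/-! ## A. Instrument predicates -/

/-- A slice DECAYS at spatial infinity (far-field silence): `‖f x‖ ≤ ε` beyond some radius, every `ε > 0`. -/
def Decays (f : E3 → E3) : Prop := ∀ ε : ℝ, 0 < ε → ∃ R : ℝ, ∀ x : E3, R ≤ ‖x‖ → ‖f x‖ ≤ ε

/-- The far field of `u` is QUIET at level `θ`: at every instant, beyond a (time-dependent) radius the
scale-invariant amplitude `√(−t)‖u(t,x)‖` is at most `θ`. -/
def FarQuiet (θ : ℝ) (u : ℝ → E3 → E3) : Prop :=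
  ∀ t : ℝ, t < 0 → ∃ R : ℝ, ∀ x : E3, R ≤ ‖x‖ → Real.sqrt (-t) * ‖u t x‖ ≤ θ

/-! ## B. Recentring (the lever): far-field limits lie in the class -/

/-- **Recentring.** For `u ∈ A_C` and any sequence of translation vectors `xs`, a subsequence of the
recentred fields `u(·, · + xs k)` converges pointwise on `t < 0` to an element of `A_C`
(translation covariance + F3). -/
theorem recentre (hu : IsTypeIAncientMild C u) (xs : ℕ → E3) :
    ∃ φ : ℕ → ℕ, StrictMono φ ∧ ∃ W : ℝ → E3 → E3, IsTypeIAncientMild C W ∧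
      ∀ t < 0, ∀ x, Tendsto (fun j => u t (x + xs (φ j))) atTop (𝓝 (W t x)) := by
  obtain ⟨φ, hφ, W, hW, hpt, -, -, -⟩ :=
    exists_tendsto_of_isTypeIAncientMild_seq C (w := fun k t x => u t (x + xs k))
      (fun k => isTypeIAncientMild_comp_add_right hu (xs k))
  exact ⟨φ, hφ, W, hW, hpt⟩

/-- Along a sequence with `k ≤ ‖xs k‖`, the shifted points `x + xs (φ j)` leave every ball. -/
theorem norm_add_ge_of_le {xs : ℕ → E3} (hxs : ∀ k : ℕ, (k : ℝ) ≤ ‖xs k‖) {φ : ℕ → ℕ}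
    (hφ : StrictMono φ) (x : E3) (R : ℝ) :
    ∀ᶠ j in atTop, R ≤ ‖x + xs (φ j)‖ := by
  obtain ⟨N, hN⟩ := exists_nat_ge (R + ‖x‖)
  refine eventually_atTop.2 ⟨N, fun j hj => ?_⟩
  have h1 : (N : ℝ) ≤ φ j := by exact_mod_cast (hj.trans (hφ.id_le j))
  have h2 : ‖xs (φ j)‖ - ‖x‖ ≤ ‖x + xs (φ j)‖ := by
    have := norm_sub_norm_le (xs (φ j)) (-x)
    rw [norm_neg, sub_neg_eq_add, add_comm] at this
    linarith
  linarith [hxs (φ j)]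

/-- A fixed nonzero vector of `E3` (used to recentre along a ray and to build periodic patterns). -/
theorem single_ne_zero : (EuclideanSpace.single 0 1 : E3) ≠ 0 := by
  intro h
  have h1 : ‖(EuclideanSpace.single 0 1 : E3)‖ = 1 := by simp
  rw [h, norm_zero] at h1
  exact zero_ne_one h1

/-! ## C. One-slice killers (tree theorems, packaged) -/

/-- ONE constant slice kills: if `W ∈ A_C` has a spatially constant slice at some `t₀ < 0` then `W ≡ 0`
(every translation fixes that slice, hence — eternity of translation symmetry — every slice; constant
slices vanish in the KNSS gauge). -/
theorem eq_zero_of_const_slice {W : ℝ → E3 → E3} (hW : IsTypeIAncientMild C W) {t₀ : ℝ} (ht₀ : t₀ < 0)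
    {c : E3} (hc : ∀ x, W t₀ x = c) : ∀ t < 0, ∀ x, W t x = 0 := by
  have hconst : ∀ t < 0, ∀ x, W t x = W t 0 := by
    intro t ht x
    have h := translate_of_translate_slice hW x ht₀ (fun y => by rw [hc, hc]) t ht 0
    simpa using h
  intro t ht x
  exact hW.eq_zero_of_slice_const (b := fun t => W t 0) hconst ht x

/-- ONE periodic slice kills: if `W ∈ A_C` has a slice periodic in a direction `e ≠ 0` then `W ≡ 0`
(`translate_of_translate_slice` + `periodicTypeIAncientLiouville`). -/
theorem eq_zero_of_periodic_slice {W : ℝ → E3 → E3} (hW : IsTypeIAncientMild C W) {t₀ : ℝ} (ht₀ : t₀ < 0)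
    {e : E3} (he : e ≠ 0) (hper : ∀ x, W t₀ (x + e) = W t₀ x) : ∀ t < 0, ∀ x, W t x = 0 :=
  periodicTypeIAncientLiouville C W hW e he (translate_of_translate_slice hW e ht₀ hper)

/-! ## D. The laws -/

/-- From the failure of decay: a divergent sequence along which the slice stays `ε`-large. -/
theorem exists_seq_of_not_decays {f : E3 → E3} (h : ¬ Decays f) :
    ∃ ε : ℝ, 0 < ε ∧ ∃ xs : ℕ → E3, (∀ k : ℕ, (k : ℝ) ≤ ‖xs k‖) ∧ ∀ k, ε < ‖f (xs k)‖ := by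
  simp only [Decays, not_forall, not_exists, not_le, exists_prop] at h
  obtain ⟨ε, hε, hR⟩ := h
  choose xs hxs using fun k : ℕ => hR (k : ℝ)
  exact ⟨ε, hε, xs, fun k => (hxs k).1, fun k => (hxs k).2⟩

/-- Transfer of decay to the recentred limit: if `f(x + xs k) → L` pointwise-along-`φ` and `f` decays while
`xs` diverges, then `L = 0`. -/
theorem limit_eq_zero_of_decays {f : E3 → E3} (hd : Decays f) {xs : ℕ → E3}
    (hxs : ∀ k : ℕ, (k : ℝ) ≤ ‖xs k‖) {φ : ℕ → ℕ} (hφ : StrictMono φ) {x L : E3}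
    (hL : Tendsto (fun j => f (x + xs (φ j))) atTop (𝓝 L)) : L = 0 := by
  have h0 : Tendsto (fun j => f (x + xs (φ j))) atTop (𝓝 0) := by
    rw [Metric.tendsto_atTop]
    intro ε hε
    obtain ⟨R, hR⟩ := hd (ε / 2) (by positivity)
    obtain ⟨N, hN⟩ := eventually_atTop.1 (norm_add_ge_of_le hxs hφ x R)
    refine ⟨N, fun j hj => ?_⟩
    rw [dist_zero_right]
    exact (hR _ (hN j hj)).trans_lt (by linarith)
  exact tendsto_nhds_unique hL h0

/-- **LAW (far-field silence is eternal).** If one slice of `u ∈ A_C` decays at spatial infinity, every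
slice does. -/
theorem decays_of_decays_slice (hu : IsTypeIAncientMild C u) {t₀ : ℝ} (ht₀ : t₀ < 0)
    (hd : Decays (u t₀)) : ∀ t < 0, Decays (u t) := by
  intro t ht
  by_contra hnd
  obtain ⟨ε, hε, xs, hxs, hbig⟩ := exists_seq_of_not_decays hnd
  obtain ⟨φ, hφ, W, hW, hconv⟩ := recentre hu xs
  -- the recentred limit has the zero slice at `t₀`
  have hW0 : ∀ x, W t₀ x = 0 := fun x => limit_eq_zero_of_decays hd hxs hφ (hconv t₀ ht₀ x)
  have hWz : ∀ s < 0, ∀ x, W s x = 0 := eq_zero_of_const_slice hW ht₀ hW0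
  -- but its slice at `t` is `ε`-large at the origin
  have hnorm : Tendsto (fun j => ‖u t (0 + xs (φ j))‖) atTop (𝓝 ‖W t 0‖) :=
    (continuous_norm.tendsto _).comp (hconv t ht 0)
  have hge : ε ≤ ‖W t 0‖ :=
    ge_of_tendsto hnorm (Eventually.of_forall fun j => by
      rw [zero_add]; exact (hbig (φ j)).le)
  rw [hWz t ht 0, norm_zero] at hge
  exact absurd hge (not_le.2 hε)

/-- **LAW (silence is eternal, iff form).** -/
theorem decays_iff_decays (hu : IsTypeIAncientMild C u) {t₀ t₁ : ℝ} (ht₀ : t₀ < 0) (ht₁ : t₁ < 0) :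
    Decays (u t₀) ↔ Decays (u t₁) :=
  ⟨fun h => decays_of_decays_slice hu ht₀ h t₁ ht₁, fun h => decays_of_decays_slice hu ht₁ h t₀ ht₀⟩

/-- **LAW (the far-field gap).** If the far field of `u ∈ A_C` is quiet at some level `θ < 1` at every
instant, then every slice decays at spatial infinity: recentred far-field limits lie in `A_θ`, which is
trivial by the time-constant gap (census A2a, `typeI_ancient_eq_zero_of_timeConstant_lt_one_noDecay`). -/
theorem decays_of_farQuiet (hu : IsTypeIAncientMild C u) {θ : ℝ} (hθ : θ < 1) (hq : FarQuiet θ u) :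
    ∀ t < 0, Decays (u t) := by
  intro t ht
  by_contra hnd
  obtain ⟨ε, hε, xs, hxs, hbig⟩ := exists_seq_of_not_decays hnd
  obtain ⟨φ, hφ, W, hW, hconv⟩ := recentre hu xs
  -- the recentred limit is quiet EVERYWHERE: `√(−s)‖W s y‖ ≤ θ`
  have hWθ : ∀ s < 0, ∀ y, Real.sqrt (-s) * ‖W s y‖ ≤ θ := by
    intro s hs y
    obtain ⟨R, hR⟩ := hq s hs
    have hlim : Tendsto (fun j => Real.sqrt (-s) * ‖u s (y + xs (φ j))‖) atTop
        (𝓝 (Real.sqrt (-s) * ‖W s y‖)) :=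
      ((continuous_norm.tendsto _).comp (hconv s hs y)).const_mul _
    refine le_of_tendsto hlim ?_
    filter_upwards [norm_add_ge_of_le hxs hφ y R] with j hj using hR _ hj
  have hWz : ∀ s < 0, ∀ x, W s x = 0 := typeI_ancient_eq_zero_of_timeConstant_lt_one_noDecay hθ hW hWθ
  have hnorm : Tendsto (fun j => ‖u t (0 + xs (φ j))‖) atTop (𝓝 ‖W t 0‖) :=
    (continuous_norm.tendsto _).comp (hconv t ht 0)
  have hge : ε ≤ ‖W t 0‖ :=
    ge_of_tendsto hnorm (Eventually.of_forall fun j => by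
      rw [zero_add]; exact (hbig (φ j)).le)
  rw [hWz t ht 0, norm_zero] at hge
  exact absurd hge (not_le.2 hε)

/-- Iterated periodicity: `w (x + n • e) = w x`. -/
theorem periodic_nat_smul {w : E3 → E3} {e : E3} (hw : ∀ x, w (x + e) = w x) (x : E3) (n : ℕ) :
    w (x + (n : ℝ) • e) = w x := by
  induction n with
  | zero => simp
  | succ n ih =>
    have : x + ((n + 1 : ℕ) : ℝ) • e = (x + (n : ℝ) • e) + e := by
      rw [Nat.cast_succ, add_smul, one_smul, add_assoc]
    rw [this, hw, ih]

/-- **LAW (asymptotic patterns are silent).** If a slice of `u ∈ A_C` is asymptotic at spatial infinity to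
a pattern `w` periodic in some direction `e ≠ 0` (`u(t₀,x) − w(x) → 0` as `‖x‖ → ∞`), then `w ≡ 0` — so that
slice decays. Recentring along `k • e`: the far-field limit has the slice `w` at `t₀`, a periodic slice,
and periodic slices kill. -/
theorem pattern_eq_zero (hu : IsTypeIAncientMild C u) {t₀ : ℝ} (ht₀ : t₀ < 0) {e : E3} (he : e ≠ 0)
    {w : E3 → E3} (hw : ∀ x, w (x + e) = w x) (ha : Decays (fun x => u t₀ x - w x)) :
    ∀ x, w x = 0 := by
  -- recentre along `xs k = (⌈k/‖e‖⌉-ish) • e`; simplest: `xs k = (k * m) • e` with `m • e` of norm ≥ 1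
  obtain ⟨m, hm⟩ : ∃ m : ℕ, 1 ≤ (m : ℝ) * ‖e‖ := by
    have he' : 0 < ‖e‖ := norm_pos_iff.2 he
    obtain ⟨m, hm⟩ := exists_nat_ge (1 / ‖e‖)
    exact ⟨m, by rwa [div_le_iff₀ he'] at hm⟩
  set xs : ℕ → E3 := fun k => ((k * m : ℕ) : ℝ) • e with hxs_def
  have hxs : ∀ k : ℕ, (k : ℝ) ≤ ‖xs k‖ := by
    intro k
    have hk : (0 : ℝ) ≤ k := Nat.cast_nonneg k
    have h1 : ‖xs k‖ = (k : ℝ) * ((m : ℝ) * ‖e‖) := by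
      simp only [hxs_def, norm_smul, Real.norm_eq_abs, Nat.cast_mul]
      rw [abs_of_nonneg (by positivity)]
      ring
    rw [h1]
    nlinarith
  obtain ⟨φ, hφ, W, hW, hconv⟩ := recentre hu xs
  -- the slice of the limit at `t₀` is the pattern
  have hWw : ∀ x, W t₀ x = w x := by
    intro x
    have hper : ∀ j, w (x + xs (φ j)) = w x := fun j => periodic_nat_smul hw x _
    have h1 : Tendsto (fun j => u t₀ (x + xs (φ j)) - w (x + xs (φ j))) atTop (𝓝 (W t₀ x - w x)) := by
      have h2 : Tendsto (fun j => w (x + xs (φ j))) atTop (𝓝 (w x)) := by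
        simp only [hper]; exact tendsto_const_nhds
      exact (hconv t₀ ht₀ x).sub h2
    have h0 : W t₀ x - w x = 0 := limit_eq_zero_of_decays (f := fun y => u t₀ y - w y) ha hxs hφ h1
    exact sub_eq_zero.1 h0
  have hWper : ∀ x, W t₀ (x + e) = W t₀ x := fun x => by rw [hWw, hWw, hw]
  have hWz := eq_zero_of_periodic_slice hW ht₀ he hWper
  intro x
  rw [← hWw, hWz t₀ ht₀ x]

/-- **LAW (far-field limits vanish).** A uniform far-field limit `c` of one slice of `u ∈ A_C` is `0`. -/
theorem farLimit_eq_zero (hu : IsTypeIAncientMild C u) {t₀ : ℝ} (ht₀ : t₀ < 0) {c : E3}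
    (ha : Decays (fun x => u t₀ x - c)) : c = 0 := by
  exact pattern_eq_zero hu ht₀ single_ne_zero (w := fun _ => c) (fun _ => rfl) ha 0

/-- An asymptotically periodic slice decays (its pattern vanishes). -/
theorem decays_of_asymptotic_pattern (hu : IsTypeIAncientMild C u) {t₀ : ℝ} (ht₀ : t₀ < 0) {e : E3}
    (he : e ≠ 0) {w : E3 → E3} (hw : ∀ x, w (x + e) = w x) (ha : Decays (fun x => u t₀ x - w x)) :
    Decays (u t₀) := by
  have hw0 := pattern_eq_zero hu ht₀ he hw ha
  intro ε hε
  obtain ⟨R, hR⟩ := ha ε hε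
  exact ⟨R, fun x hx => by simpa [hw0 x] using hR x hx⟩

end Summit.NavierStokesRegularity.NavierStokesRegularity.Theorems.ScenarioCensus.FarfieldMeter

end
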